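import Summits.Ventures.PercRepro.C041TriangleFirstLevel

/-!
# THE FIRST LEVEL, GENERAL FORM — first-level certificates with free carrier atoms, and `H` on every pair of
certified stars (mine-3, gen 68; C-041.md §21 (bh) (4))

`C041TriangleFirstLevel` decomposes a star with `Λ₁, Λ₂ ≥ 0` into the leaf at `(1 + A − B)/2` and marks.  The
marked leaves `v s · v 0` and `v t · v 1` are better carriers of `B` and `A` than the bare marks (`v s · v 0` has
`L₁ + M₂ − 2L₀ = −s(1 − s) < 0`), so the first level `K₁ᵐ` reaches well beyond `Λ₁, Λ₂ ≥ 0`.  A FIRST-LEVEL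
CERTIFICATE (`FirstLevel A B P₁ P₂`) names three atoms — `s₀` for the leaf carrying `M₀ = AB`, `s` for the
`B`-carrier `v s · v 0`, `t` for the `A`-carrier `v t · v 1` — and weights `μ, MB, MA` with the three moment
equations, the remaining mass `r > 0` and the two residual type counts `R₁, R₂ ≥ 2r`; the rest of the mass sits on
`X(1,1)`, `X(n+1,1)`, `X(1,n+1)` as before (`firstLevelGen_decomp`, exact).  Exact simplex on the 8-grid finds no
star in `K₁ᵐ` without such a certificate (grid 16 for the atoms): 21 / 21, 26 / 26, 38 / 38 random 3-, 4-, 5-leaf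
stars (24ths) — against 12, 19, 32 for the bare criterion.  THE TRANSFER `InCone_thetaTri_of_FirstLevel`: a
certified star is settled against every cone element `w′` that is settled against every marked leaf
`v x`, `v x · v 0`, `v x · v 1`.  **THEOREM (H ON THE FIRST LEVEL, GENERAL FORM)**
`InCone_thetaTri_FirstLevel_FirstLevel`: `θ_△(V a, V b) ∈ cone` for every two certified stars, whatever their
numbers of leaves; `InCone_thetaTri_FirstLevel_star3Marks`: a certified star against every star with ≤ 3 interior
leaves and any marks; `FirstLevel_of_simple`: the bare criterion `A + B < 1`, `Λ₁ ≥ 0`, `Λ₂ ≥ 0` is a certificate.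
-/

namespace PercRepro

namespace RelaxedTriangle

open TreeClosure

/-- A FIRST-LEVEL CERTIFICATE for the invariants `(A, B, P₁, P₂)` of a star: atoms `s₀ ∈ (0, 1)` (the leaf carrying
`M₀ = AB`), `s ∈ [0, 1]` (the `B`-carrier `v s · v 0`), `t ∈ [0, 1]` (the `A`-carrier `v t · v 1`), the bare marks `v 0`, `v 1`
as further carriers, weights `μ, MB, MB', MA, MA' ≥ 0` with `μ s₀(1 − s₀) = AB`, `MB (1 − s) + MB' = B − μ(1 − s₀)`,
`MA t + MA' = A − μ s₀`, the remaining mass `r = 1 − μ − MA − MA' − MB − MB' > 0` and the residual type counts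
`R₁ = P₁ − μ(1 + s₀²) − MB(1 + s²) − MB' − 2MA(1 + t²) − 2MA'`,
`R₂ = P₂ − μ(1 + (1 − s₀)²) − 2MB(1 + (1 − s)²) − 2MB' − MA(1 + (1 − t)²) − MA'`, both `≥ 2r`. -/
def FirstLevel (A B P₁ P₂ : ℝ) : Prop :=
  ∃ s₀ s t μ MA MA' MB MB' r R₁ R₂ : ℝ, (0 < s₀ ∧ s₀ < 1) ∧ (0 ≤ s ∧ s ≤ 1) ∧ (0 ≤ t ∧ t ≤ 1) ∧
    μ * (s₀ * (1 - s₀)) = A * B ∧ MB * (1 - s) + MB' = B - μ * (1 - s₀) ∧ MA * t + MA' = A - μ * s₀ ∧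
    r = 1 - μ - MA - MA' - MB - MB' ∧
    R₁ = P₁ - μ * (1 + s₀ ^ 2) - MB * (1 + s ^ 2) - MB' - 2 * MA * (1 + t ^ 2) - 2 * MA' ∧
    R₂ = P₂ - μ * (1 + (1 - s₀) ^ 2) - 2 * MB * (1 + (1 - s) ^ 2) - 2 * MB' - MA * (1 + (1 - t) ^ 2) - MA' ∧
    0 ≤ μ ∧ 0 ≤ MA ∧ 0 ≤ MA' ∧ 0 ≤ MB ∧ 0 ≤ MB' ∧ 0 < r ∧ 2 * r ≤ R₁ ∧ 2 * r ≤ R₂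

/-- **THE GENERAL FIRST-LEVEL DECOMPOSITION** (scaled by `2^(n+1) − 2`): under the three moment equations and the
definitions of `r, R₁, R₂`, the six-vector `(1, P₁, P₂, AB, A, B)` times `2^(n+1) − 2` is the displayed combination
of `v s₀`, `v s · v 0`, `v t · v 1`, `X(1,1)`, `X(n+1,1)`, `X(1,n+1)`. -/
theorem firstLevelGen_decomp (A B P₁ P₂ s₀ s t μ MA MA' MB MB' r R₁ R₂ : ℝ) (n : ℕ)
    (hμ : μ * (s₀ * (1 - s₀)) = A * B) (hMB : MB * (1 - s) + MB' = B - μ * (1 - s₀))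
    (hMA : MA * t + MA' = A - μ * s₀) (hr : r = 1 - μ - MA - MA' - MB - MB')
    (hR₁ : R₁ = P₁ - μ * (1 + s₀ ^ 2) - MB * (1 + s ^ 2) - MB' - 2 * MA * (1 + t ^ 2) - 2 * MA')
    (hR₂ : R₂ = P₂ - μ * (1 + (1 - s₀) ^ 2) - 2 * MB * (1 + (1 - s) ^ 2) - 2 * MB' - MA * (1 + (1 - t) ^ 2) - MA') :
    ((2 : ℝ) ^ (n + 1) - 2) • (![1, P₁, P₂, A * B, A, B] : Vec6) =
      (((2 : ℝ) ^ (n + 1) - 2) * μ) • v s₀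
      + (((2 : ℝ) ^ (n + 1) - 2) * MB) • (v s * v 0)
      + (((2 : ℝ) ^ (n + 1) - 2) * MB') • v 0
      + (((2 : ℝ) ^ (n + 1) - 2) * MA) • (v t * v 1)
      + (((2 : ℝ) ^ (n + 1) - 2) * MA') • v 1
      + (r * ((2 : ℝ) ^ (n + 1) - 2) - (R₁ - 2 * r) - (R₂ - 2 * r)) • (v 1 * v 0)
      + (R₁ - 2 * r) • (v 1 ^ (n + 1) * v 0)
      + (R₂ - 2 * r) • (v 1 * v 0 ^ (n + 1)) := by
  subst hr hR₁ hR₂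
  rw [pow_v_one_eq (n + 1) (by omega), pow_v_zero_eq (n + 1) (by omega)]
  ext i
  simp only [Pi.smul_apply, Pi.add_apply, Pi.mul_apply, smul_eq_mul, v]
  fin_cases i <;> simp <;>
    first
    | ring1
    | linear_combination (-((2 : ℝ) ^ (n + 1) - 2)) * hμ
    | linear_combination (-((2 : ℝ) ^ (n + 1) - 2)) * hMA
    | linear_combination (-((2 : ℝ) ^ (n + 1) - 2)) * hMB

/-- **THE FIRST-LEVEL TRANSFER, GENERAL FORM**: a certified `(1, P₁, P₂, AB, A, B)` is settled against every cone
element `w′` that is settled against every marked leaf `v x`, `v x · v 0`, `v x · v 1` (`x ∈ [0, 1]`). -/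
theorem InCone_thetaTri_of_FirstLevel {A B P₁ P₂ : ℝ} (h : FirstLevel A B P₁ P₂) {w' : Vec6} (hw' : InCone w')
    (h0 : ∀ x, 0 ≤ x ∧ x ≤ 1 → InCone (thetaTri (v x) w'))
    (hB : ∀ x, 0 ≤ x ∧ x ≤ 1 → InCone (thetaTri (v x * v 0) w'))
    (hA : ∀ x, 0 ≤ x ∧ x ≤ 1 → InCone (thetaTri (v x * v 1) w')) :
    InCone (thetaTri (![1, P₁, P₂, A * B, A, B] : Vec6) w') := by
  obtain ⟨s₀, s, t, μ, MA, MA', MB, MB', r, R₁, R₂, hs₀, hs, ht, hμ, hMB, hMA, hr, hR₁, hR₂, hμ0, hMA0, hMA0', hMB0,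
    hMB0', hr0, h1, h2⟩ := h
  obtain ⟨n, hn⟩ := pow_unbounded_of_one_lt (((R₁ - 2 * r) + (R₂ - 2 * r)) / r + 2) (one_lt_two : (1 : ℝ) < 2)
  have hq : 0 ≤ ((R₁ - 2 * r) + (R₂ - 2 * r)) / r := div_nonneg (by linarith) hr0.le
  have h2n : (2 : ℝ) ^ n ≤ (2 : ℝ) ^ (n + 1) := by
    rw [pow_succ]; nlinarith [pow_pos (by norm_num : (0 : ℝ) < 2) n]
  have hN4 : 0 < (2 : ℝ) ^ (n + 1) - 2 := by linarith
  have hN2 : (R₁ - 2 * r) + (R₂ - 2 * r) ≤ r * ((2 : ℝ) ^ (n + 1) - 2) := by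
    have hle : ((R₁ - 2 * r) + (R₂ - 2 * r)) / r ≤ (2 : ℝ) ^ (n + 1) - 2 := by linarith
    have := (div_le_iff₀ hr0).1 hle
    linarith
  have key : ((2 : ℝ) ^ (n + 1) - 2) • thetaTri (![1, P₁, P₂, A * B, A, B] : Vec6) w' =
      (((2 : ℝ) ^ (n + 1) - 2) * μ) • thetaTri (v s₀) w'
      + (((2 : ℝ) ^ (n + 1) - 2) * MB) • thetaTri (v s * v 0) w'
      + (((2 : ℝ) ^ (n + 1) - 2) * MB') • thetaTri (v 0) w'
      + (((2 : ℝ) ^ (n + 1) - 2) * MA) • thetaTri (v t * v 1) w'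
      + (((2 : ℝ) ^ (n + 1) - 2) * MA') • thetaTri (v 1) w'
      + (r * ((2 : ℝ) ^ (n + 1) - 2) - (R₁ - 2 * r) - (R₂ - 2 * r)) • thetaTri (v 1 * v 0) w'
      + (R₁ - 2 * r) • thetaTri (v 1 ^ (n + 1) * v 0) w'
      + (R₂ - 2 * r) • thetaTri (v 1 * v 0 ^ (n + 1)) w' := by
    rw [← thetaTri_smul_left,
      firstLevelGen_decomp A B P₁ P₂ s₀ s t μ MA MA' MB MB' r R₁ R₂ n hμ hMB hMA hr hR₁ hR₂]
    simp only [thetaTri_add_left, thetaTri_smul_left]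
  have hn1 : InCone (thetaTri (v 1 ^ (n + 1) * v 0) w') := by
    have := InCone_thetaTri_marks_any' (n + 1) 1 hw'
    rwa [pow_one] at this
  have h1n : InCone (thetaTri (v 1 * v 0 ^ (n + 1)) w') := by
    have := InCone_thetaTri_marks_any' 1 (n + 1) hw'
    rwa [pow_one] at this
  have hsum : InCone (((2 : ℝ) ^ (n + 1) - 2) • thetaTri (![1, P₁, P₂, A * B, A, B] : Vec6) w') := by
    rw [key]
    refine ((((((InCone.smul _ ?_ (h0 s₀ ⟨hs₀.1.le, hs₀.2.le⟩)).add
      (InCone.smul _ ?_ (hB s hs))).add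
      (InCone.smul _ ?_ (InCone_thetaTri_v0_any hw'))).add
      (InCone.smul _ ?_ (hA t ht))).add
      (InCone.smul _ ?_ (InCone_thetaTri_v1_any hw'))).add
      (InCone.smul _ ?_ (InCone_thetaTri_X11 hw'))).add (InCone.smul _ ?_ hn1) |>.add (InCone.smul _ ?_ h1n)
    · exact mul_nonneg hN4.le hμ0
    · exact mul_nonneg hN4.le hMB0
    · exact mul_nonneg hN4.le hMB0'
    · exact mul_nonneg hN4.le hMA0
    · exact mul_nonneg hN4.le hMA0'
    · linarith
    · linarith
    · linarith
  have := InCone.smul ((2 : ℝ) ^ (n + 1) - 2)⁻¹ (inv_nonneg.2 hN4.le) hsum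
  rwa [smul_smul, inv_mul_cancel₀ hN4.ne', one_smul] at this

/-- The transfer for a star `a` with a first-level certificate for its invariants. -/
theorem InCone_thetaTri_of_FirstLevel_star {m : ℕ} (a : Fin m → ℝ)
    (h : FirstLevel (V a 4) (V a 5) (V a 1) (V a 2)) {w' : Vec6} (hw' : InCone w')
    (h0 : ∀ x, 0 ≤ x ∧ x ≤ 1 → InCone (thetaTri (v x) w'))
    (hB : ∀ x, 0 ≤ x ∧ x ≤ 1 → InCone (thetaTri (v x * v 0) w'))
    (hA : ∀ x, 0 ≤ x ∧ x ≤ 1 → InCone (thetaTri (v x * v 1) w')) :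
    InCone (thetaTri (V a) w') := by
  rw [V_eq_vec a]
  exact InCone_thetaTri_of_FirstLevel h hw' h0 hB hA

/-- A marked leaf with at most one mark against a marked leaf with at most one mark (the three seeds of the
transfer, in the normal form `v x * v 0`, `v x * v 1`, `v x`). -/
theorem InCone_thetaTri_leafMark1_leafMark1 (x y : ℝ) (hx : 0 ≤ x ∧ x ≤ 1) (hy : 0 ≤ y ∧ y ≤ 1) :
    InCone (thetaTri (v x) (v y)) ∧ InCone (thetaTri (v x) (v y * v 0)) ∧ InCone (thetaTri (v x) (v y * v 1)) ∧
    InCone (thetaTri (v x * v 0) (v y)) ∧ InCone (thetaTri (v x * v 0) (v y * v 0)) ∧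
    InCone (thetaTri (v x * v 0) (v y * v 1)) ∧ InCone (thetaTri (v x * v 1) (v y)) ∧
    InCone (thetaTri (v x * v 1) (v y * v 0)) ∧ InCone (thetaTri (v x * v 1) (v y * v 1)) := by
  have h := fun p q p' q' => InCone_thetaTri_leafMarks_leafMarks x y hx hy p q p' q'
  refine ⟨?_, ?_, ?_, ?_, ?_, ?_, ?_, ?_, ?_⟩
  · simpa using h 0 0 0 0
  · simpa using h 0 0 0 1
  · simpa using h 0 0 1 0
  · simpa using h 0 1 0 0
  · simpa using h 0 1 0 1
  · simpa using h 0 1 1 0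
  · simpa using h 1 0 0 0
  · simpa using h 1 0 0 1
  · simpa using h 1 0 1 0

/-- **THEOREM (H ON THE FIRST LEVEL, GENERAL FORM)**: `θ_△(V a, V b) ∈ cone` for every two stars with first-level
certificates, whatever their numbers of leaves. -/
theorem InCone_thetaTri_FirstLevel_FirstLevel {m m' : ℕ} (a : Fin m → ℝ) (b : Fin m' → ℝ)
    (hb : ∀ i, 0 ≤ b i ∧ b i ≤ 1)
    (hA : FirstLevel (V a 4) (V a 5) (V a 1) (V a 2)) (hB : FirstLevel (V b 4) (V b 5) (V b 1) (V b 2)) :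
    InCone (thetaTri (V a) (V b)) := by
  refine InCone_thetaTri_of_FirstLevel_star a hA (InCone_V b hb) ?_ ?_ ?_
  · intro x hx
    rw [thetaTri_comm]
    refine InCone_thetaTri_of_FirstLevel_star b hB (InCone_v x hx) ?_ ?_ ?_
    · intro y hy; exact (InCone_thetaTri_leafMark1_leafMark1 y x hy hx).1
    · intro y hy; exact (InCone_thetaTri_leafMark1_leafMark1 y x hy hx).2.2.2.1
    · intro y hy; exact (InCone_thetaTri_leafMark1_leafMark1 y x hy hx).2.2.2.2.2.2.1
  · intro x hx
    rw [thetaTri_comm]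
    refine InCone_thetaTri_of_FirstLevel_star b hB ((InCone_v x hx).mul InCone_v0) ?_ ?_ ?_
    · intro y hy; exact (InCone_thetaTri_leafMark1_leafMark1 y x hy hx).2.1
    · intro y hy; exact (InCone_thetaTri_leafMark1_leafMark1 y x hy hx).2.2.2.2.1
    · intro y hy; exact (InCone_thetaTri_leafMark1_leafMark1 y x hy hx).2.2.2.2.2.2.2.1
  · intro x hx
    rw [thetaTri_comm]
    refine InCone_thetaTri_of_FirstLevel_star b hB ((InCone_v x hx).mul InCone_v1) ?_ ?_ ?_
    · intro y hy; exact (InCone_thetaTri_leafMark1_leafMark1 y x hy hx).2.2.1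
    · intro y hy; exact (InCone_thetaTri_leafMark1_leafMark1 y x hy hx).2.2.2.2.2.1
    · intro y hy; exact (InCone_thetaTri_leafMark1_leafMark1 y x hy hx).2.2.2.2.2.2.2.2

/-- **A CERTIFIED STAR AGAINST EVERY STAR WITH ≤ 3 INTERIOR LEAVES AND ANY MARKS**. -/
theorem InCone_thetaTri_FirstLevel_star3Marks {m : ℕ} (a : Fin m → ℝ)
    (hA : FirstLevel (V a 4) (V a 5) (V a 1) (V a 2))
    (b c d : ℝ) (hb : 0 ≤ b ∧ b ≤ 1) (hc : 0 ≤ c ∧ c ≤ 1) (hd : 0 ≤ d ∧ d ≤ 1) (p q : ℕ) :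
    InCone (thetaTri (V a) (v b * v c * v d * (v 1 ^ p * v 0 ^ q))) := by
  refine InCone_thetaTri_of_FirstLevel_star a hA
    ((((InCone_v b hb).mul (InCone_v c hc)).mul (InCone_v d hd)).mul
      ((InCone_pow_v_one p).mul (InCone_pow_v_zero q))) ?_ ?_ ?_
  · intro x hx
    exact InCone_thetaTri_leaf_star3_marks b c d x hb hc hd hx p q
  · intro x hx
    simpa using InCone_thetaTri_leafMarks_star3Marks b c d x hb hc hd hx 0 1 p q
  · intro x hx
    simpa using InCone_thetaTri_leafMarks_star3Marks b c d x hb hc hd hx 1 0 p q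

/-- **THE BARE CRITERION IS A CERTIFICATE**: `A, B ≥ 0`, `A + B < 1`, `P₁ + B + AB ≥ 2`, `P₂ + A + AB ≥ 2` give a
first-level certificate with the leaf at `(1 + A − B)/2` and the bare marks as carriers (`s = 0`, `t = 1`). -/
theorem FirstLevel_of_simple (A B P₁ P₂ : ℝ) (hA : 0 ≤ A) (hB : 0 ≤ B) (hAB : A + B < 1)
    (h1 : 2 ≤ P₁ + B + A * B) (h2 : 2 ≤ P₂ + A + A * B) : FirstLevel A B P₁ P₂ := by
  have hE1 : 0 < 1 - A + B := by linarith
  have hE2 : 0 < 1 + A - B := by linarith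
  have hE1' : 1 - A + B ≠ 0 := hE1.ne'
  have hE2' : 1 + A - B ≠ 0 := hE2.ne'
  have hE : (1 - A + B) * (1 + A - B) ≠ 0 := mul_ne_zero hE1' hE2'
  have hμ : 4 * A * B / ((1 - A + B) * (1 + A - B)) * ((1 + A - B) / 2 * (1 - (1 + A - B) / 2)) = A * B := by
    rw [div_mul_eq_mul_div, div_eq_iff hE]
    ring
  have hμA : 4 * A * B / ((1 - A + B) * (1 + A - B)) * ((1 + A - B) / 2) ≤ A := by
    have : 4 * A * B / ((1 - A + B) * (1 + A - B)) * ((1 + A - B) / 2) = 2 * A * B / (1 - A + B) := by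
      rw [div_mul_eq_mul_div, div_eq_div_iff hE hE1']
      ring
    rw [this, div_le_iff₀ hE1]
    nlinarith
  have hμB : 4 * A * B / ((1 - A + B) * (1 + A - B)) * (1 - (1 + A - B) / 2) ≤ B := by
    have : 4 * A * B / ((1 - A + B) * (1 + A - B)) * (1 - (1 + A - B) / 2) = 2 * A * B / (1 + A - B) := by
      rw [div_mul_eq_mul_div, div_eq_div_iff hE hE2']
      ring
    rw [this, div_le_iff₀ hE2]
    nlinarith
  refine ⟨(1 + A - B) / 2, 0, 0, 4 * A * B / ((1 - A + B) * (1 + A - B)), 0,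
    A - 4 * A * B / ((1 - A + B) * (1 + A - B)) * ((1 + A - B) / 2), 0,
    B - 4 * A * B / ((1 - A + B) * (1 + A - B)) * (1 - (1 + A - B) / 2),
    1 - A - B, P₁ - 2 * A - B + A * B, P₂ - A - 2 * B + A * B,
    ⟨by linarith, by linarith⟩, ⟨le_rfl, zero_le_one⟩, ⟨le_rfl, zero_le_one⟩, hμ, by ring, by ring, ?_, ?_, ?_,
    by positivity, le_rfl, by linarith, le_rfl, by linarith, by linarith, by linarith, by linarith⟩
  · ring
  · linear_combination (-1 : ℝ) * hμ
  · linear_combination (-1 : ℝ) * hμ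

end RelaxedTriangle

end PercRepro
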